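import Summits.ResolutionOfSingularities.ResolutionOfSingularities.Theorems.ExitCutTransport
import HarnessLib

/-!
# ExitCutTransport2 — decomp-res node «PortCut» (lens-2 g28, critic row 219 CLEARED · MAP +1 ONCE (D1: the
multi-unit port proved for every n)), tree file 2/5 of the node

Content VERBATIM from the decomp-res lens-2 g28 node `HOME/decomp-res-lens-2/g28/PortCut.lean` (pin 67bf9bb7; no
carry, imports the landed g27 node «ExitCut» + Literature; ns `…Theses.PortCut` ↦ `…Theorems.PortCut`); HOME =
run/shared/lean/pub/decomp-res; critic CRITIC-LEDGER row 219 CLEARED · MAP +1 ONCE (D1): `componentPackagePort_holds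
: ∀ n, ComponentPackagePort n` in kernel via `multiUnitPackageTransport_holds`; landing orders LANDING NOTE :1549 +
rider 12:16:46Z — provenance and critic text in full (and the lens header verbatim) in `ExitCutTransport`.  `--kind
proof --supports stmt-ResolutionOfSingularities-29273`.

## This file

Continuation 2/2 of `ExitCutTransport` (same namespace / sections of the node, cut at the tree's 400-line cap;
section variables / opens replayed): scopes `Seq` — carries `exists_extend_weak`, `restrict_pointwise`,
`tauTwo_restrict`, `tauTwo_of_isPullbackAlong`.

[WRITER NOTE (decomp-res writer g13): file split only (tree files ≤ 400 lines); sections, section `variable`s /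
`open`s and every declaration exactly as in the lens (namespace renamed Theses ↦ Theorems, the HOME-only
dupNamespace-linter line dropped; `noncomputable section` and the five file-level `open` lines replayed in every
file). Audit-cone caveat of the lens honoured: each pattern-matching recursive helper
(`isRegular_top_of_weakAdmissible`, `stalkIdeal_transformMarked_of_not_mem`, `WeakAdmissible.restrict`) stays in the
same file as a tactic-style proof referencing it whenever the cap allows; a cut between them changes nothing for the kernel.]

(Sources: Hironaka1964 Ch. III §§1–3, §7; Giraud1975; CossartJannsenSaito2020 Ch. 2, Ch. 8–9; EGAIV4 §16–§17;
Matsumura1987 §28–§30; CossartPiltant2008 Prop. 4.2; BierstoneMilman1997 §3; Cutkosky2004 Ch. 6–7; Kollar2007 §3;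
StacksProject 01WV / 0806 / 080A.)
-/

noncomputable section

open CategoryTheory AlgebraicGeometry IsLocalRing TopologicalSpace Topology
open Literature.AlgebraicGeometry.Resolution
open Summit.ResolutionOfSingularities.ResolutionOfSingularities.Theorems
open Summit.ResolutionOfSingularities.ResolutionOfSingularities.Theorems.WeakOrderReduction
open Summit.ResolutionOfSingularities.ResolutionOfSingularities.Theorems.FaceFormCutClasses

namespace Summit.ResolutionOfSingularities.ResolutionOfSingularities.Theorems.PortCut

section Seq

/-- **EXTENSION of a weakly admissible sequence from an open over a closed set** (the snc-free twin of the
tree's `CentreSeq.exists_extend_of_centresOver`, same construction: at each stage the centre of `t` is the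
reduced closure of the image of the centre of `s` — `comap_vanishingIdeal_closureImage_support`,
`support_vanishingIdeal_closureImage_subset`, `isRegular_subscheme_vanishingIdeal_closureImage`,
`exists_eq_of_mem_support_vanishingIdeal_closureImage`, `blowup.map_π`, `blowup.range_map`,
`MarkedIdeal.transform_comap_of_isOpenImmersion`). [folklore] -/
theorem exists_extend_weak {U : Scheme.{0}} (s : CentreSeq U) :
    ∀ {X : Scheme.{0}} [IsLocallyNoetherian X] (j : U ⟶ X) [IsOpenImmersion j]
      (M : MarkedIdeal X) (T : Set X), IsClosed T → T ⊆ Set.range j →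
      WeakAdmissible s (M.comap j) → s.CentresOver (j ⁻¹' T) →
      ∃ t : CentreSeq X, WeakAdmissible t M ∧ t.CentresOver T ∧ CentreSeq.IsPullbackAlong j t s := by
  induction s with
  | nil U =>
    intro X _ j _ M T _ _ _ _
    exact ⟨.nil X, trivial, trivial, trivial⟩
  | cons C rest ih =>
    intro X _ j _ M T hT hTj hadm hover
    obtain ⟨hCsupp, hCreg, hrest⟩ := (weakAdmissible_cons C rest _).mp hadm
    obtain ⟨hCT, hrestT⟩ := (CentreSeq.centresOver_cons C rest _).mp hover
    haveI : IsReduced C.subscheme := hCreg.isReduced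
    have hC : C.radical = C := radical_eq_of_isReduced_subscheme C
    haveI : IsLocallyNoetherian _ := LocallyOfFiniteType.isLocallyNoetherian j
    haveI : IsLocallyNoetherian (blowup C) := CentreSeq.isLocallyNoetherian_blowup C
    obtain ⟨Z, hZ⟩ : ∃ Z : X.IdealSheafData,
        Z = Scheme.IdealSheafData.vanishingIdeal (closureImage j (C.support : Set _)) := ⟨_, rfl⟩
    have hZj : Z.comap j = C := by rw [hZ]; exact comap_vanishingIdeal_closureImage_support j hC
    have hZT : (Z.support : Set X) ⊆ T := by
      rw [hZ]; exact support_vanishingIdeal_closureImage_subset j hT hCT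
    have hZreg : Scheme.IsRegular Z.subscheme := by
      rw [hZ]; exact isRegular_subscheme_vanishingIdeal_closureImage j hCreg hT hTj hCT
    have hZsupp : (Z.support : Set X) ⊆ M.support := by
      intro y hy
      rw [hZ] at hy
      obtain ⟨x', rfl, hx'⟩ := exists_eq_of_mem_support_vanishingIdeal_closureImage j hC hT hTj hCT hy
      have := hCsupp hx'
      change j x' ∈ M.support
      rw [← Set.mem_preimage, ← MarkedIdeal.support_comap_of_isOpenImmersion j M]
      exact this
    haveI : IsLocallyNoetherian (blowup Z) := CentreSeq.isLocallyNoetherian_blowup Z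
    obtain ⟨g, _, hg, hgrange⟩ : ∃ (g : blowup C ⟶ blowup Z) (_ : IsOpenImmersion g),
        g ≫ blowup.π Z = blowup.π C ≫ j ∧ Set.range g = blowup.π Z ⁻¹' Set.range j := by
      subst hZj
      exact ⟨blowup.map Z j, inferInstance, blowup.map_π Z j, blowup.range_map Z j⟩
    have hadm' : WeakAdmissible rest ((M.transform (blowup.π Z) Z).comap g) := by
      rw [MarkedIdeal.transform_comap_of_isOpenImmersion j g hg Z M, hZj]
      exact hrest
    have hT' : IsClosed (blowup.π Z ⁻¹' T) := hT.preimage (blowup.π Z).continuous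
    have hTj' : blowup.π Z ⁻¹' T ⊆ Set.range g := by
      rw [hgrange]; exact Set.preimage_mono hTj
    have hover' : rest.CentresOver (g ⁻¹' (blowup.π Z ⁻¹' T)) := by
      have : g ⁻¹' (blowup.π Z ⁻¹' T) = blowup.π C ⁻¹' (j ⁻¹' T) := by
        rw [← Set.preimage_comp, ← Set.preimage_comp, ← TopCat.coe_comp, ← TopCat.coe_comp,
          ← Scheme.Hom.comp_base, ← Scheme.Hom.comp_base, hg]
      rw [this]; exact hrestT
    obtain ⟨rest', hadmR, hoverR, hpb⟩ := ih g (M.transform (blowup.π Z) Z) _ hT' hTj' hadm' hover'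
    refine ⟨.cons Z rest', (weakAdmissible_cons Z rest' M).mpr ⟨hZsupp, hZreg, hadmR⟩,
      (CentreSeq.centresOver_cons Z rest' T).mpr ⟨hZT, hoverR⟩, ⟨hZj.symm, g, hg, hpb⟩⟩

/-- **Pointwise comparison along the restriction to an open** `j : U → X`: at a point `x₀` of the top of
`s|U`, with `ι = s.restrictι j : (s|U)_r → X_r` (an open immersion): the composites agree, the order of the
transformed ideal and Hironaka's `τ` are those at `ι x₀` (`CentreSeq.restrict_comp`,
`CentreSeq.transformMarked_restrict`, §T). [folklore] -/
theorem restrict_pointwise {X U : Scheme.{0}} [IsLocallyNoetherian X] (s : CentreSeq X) (j : U ⟶ X)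
    [IsOpenImmersion j] (M : MarkedIdeal X) (hT : Scheme.IsRegular s.top)
    (hT' : Scheme.IsRegular (s.restrict j).top) (x₀ : (s.restrict j).top) (μ : ℕ) :
    j ((s.restrict j).comp x₀) = s.comp (s.restrictι j x₀) ∧
    idealOrder ((s.restrict j).transformMarked (M.comap j)).ideal x₀ =
      idealOrder (s.transformMarked M).ideal (s.restrictι j x₀) ∧
    tauAt hT' ((s.restrict j).transformMarked (M.comap j)).ideal μ x₀ =
      tauAt hT (s.transformMarked M).ideal μ (s.restrictι j x₀) := by
  haveI := s.isOpenImmersion_restrictι j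
  have e := CentreSeq.transformMarked_restrict s j M
  change (s.restrict j).transformMarked (M.comap j) = _ at e
  have hI : ((s.restrict j).transformMarked (M.comap j)).ideal =
      (s.transformMarked M).ideal.comap (s.restrictι j) := by rw [e]
  have hst : stalkIdeal ((s.restrict j).transformMarked (M.comap j)).ideal x₀ =
      (stalkIdeal (s.transformMarked M).ideal (s.restrictι j x₀)).map ((s.restrictι j).stalkMap x₀).hom := by
    rw [hI, stalkIdeal_comap_eq_map_stalkMap]
  refine ⟨?_, idealOrder_eq_of_isIso_stalkMap _ _ _ hst, tauAt_eq_of_isIso_stalkMap _ hT hT' _ _ μ hst⟩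
  rw [← Scheme.Hom.comp_apply, ← Scheme.Hom.comp_apply, CentreSeq.restrict_comp]

/-- **The package property restricts**: if after `s` every point over `S` of order `μ` has `τ ≥ 2`, then after
`s|U` every point over `j⁻¹ S` of order `μ` has `τ ≥ 2` (for the restricted marked ideal). [folklore] -/
theorem tauTwo_restrict {X U : Scheme.{0}} [IsLocallyNoetherian X] (s : CentreSeq X) (j : U ⟶ X)
    [IsOpenImmersion j] (M : MarkedIdeal X) (S : Set X) (hT : Scheme.IsRegular s.top)
    (hT' : Scheme.IsRegular (s.restrict j).top)
    (h : ∀ x : s.top, s.comp x ∈ S → idealOrder (s.transformMarked M).ideal x = (M.mult : ℕ∞) →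
      2 ≤ tauAt hT (s.transformMarked M).ideal M.mult x) :
    ∀ x₀ : (s.restrict j).top, j ((s.restrict j).comp x₀) ∈ S →
      idealOrder ((s.restrict j).transformMarked (M.comap j)).ideal x₀ = (M.mult : ℕ∞) →
      2 ≤ tauAt hT' ((s.restrict j).transformMarked (M.comap j)).ideal M.mult x₀ := by
  intro x₀ hx hox
  obtain ⟨hc, ho, hτ⟩ := restrict_pointwise s j M hT hT' x₀ M.mult
  rw [hτ]
  exact h _ (hc ▸ hx) (ho ▸ hox)

/-- **The package property descends from the induced sequence**: if `t` on `X` induces `u` on the open `U`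
along `j` (`IsPullbackAlong j t u`, so `u = t|U`) and `S ⊆ j(U)`, the `τ ≥ 2` property of `u` over `S`
gives that of `t` over `S` (`range (t.restrictι j) = t.comp⁻¹ (range j)`, tree
`range_eq_preimage_range_of_isPullback` with `CentreSeq.isPullback_restrict`). [folklore] -/
theorem tauTwo_of_isPullbackAlong {X U : Scheme.{0}} [IsLocallyNoetherian X] (j : U ⟶ X) [IsOpenImmersion j]
    (t : CentreSeq X) (u : CentreSeq U) (hpb : CentreSeq.IsPullbackAlong j t u) (M : MarkedIdeal X)
    {S : Set X} (hS : S ⊆ Set.range j) (hTu : Scheme.IsRegular u.top) (hTt : Scheme.IsRegular t.top)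
    (h : ∀ x₀ : u.top, j (u.comp x₀) ∈ S → idealOrder (u.transformMarked (M.comap j)).ideal x₀ = (M.mult : ℕ∞) →
      2 ≤ tauAt hTu (u.transformMarked (M.comap j)).ideal M.mult x₀) :
    ∀ x : t.top, t.comp x ∈ S → idealOrder (t.transformMarked M).ideal x = (M.mult : ℕ∞) →
      2 ≤ tauAt hTt (t.transformMarked M).ideal M.mult x := by
  obtain rfl : u = t.restrict j := by rw [hpb.eq_comap, CentreSeq.restrict_eq_comap]
  intro x hx hox
  have hxr : x ∈ Set.range (t.restrictι j) := by
    rw [range_eq_preimage_range_of_isPullback (CentreSeq.isPullback_restrict t j)]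
    exact hS hx
  obtain ⟨x₀, rfl⟩ := hxr
  obtain ⟨hc, ho, hτ⟩ := restrict_pointwise t j M hTt hTu x₀ M.mult
  rw [← hτ]
  exact h x₀ (hc ▸ hx) (ho ▸ hox)

end Seq

end Summit.ResolutionOfSingularities.ResolutionOfSingularities.Theorems.PortCut
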